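import Mathlib
import Summits.ValiantsHypothesis.ValiantsHypothesis.Theorems.DivisionGapPerMultiplesHardStubTypedDecomposition

/-!
# Crux `DivisionGap.ZeroOneTransfer` (stmt-ValiantsHypothesis-5066), line `charged-uncharged` —
stub `stub_dimerTypedDecomposition` (D7, TYPED ROW-SUPPORT-BALANCED DECOMPOSITION, vertex-indexed
variables)

Port of the landed `PerMultiplesHard.TypedDecomposition.stub_typedDecomposition` (variables
`Fin n × Fin n`, rows `Fin n`) to variables `(Fin n × Fin n) × (Fin n × Fin n)` (rows = first
vertices `Fin n × Fin n`, of which there are `n * n`).  We prove the statement once for an arbitrary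
finite row type `ι` and column type `κ` (`typedDecomposition_general`, window
`|ι| < 3 · #{ρ ≠ 0} ≤ 2 |ι|` under `3 ≤ |ι|`) and specialise.

Proof (Jerrum–Snir's balanced decomposition run with the ROW-SUPPORT COUNT, plus gate typing over
`ℝ≥0`; the generic descent `exists_window_operand`, the subadditivity lemmas `card_image_fst_vars_*`
and the zeroing bookkeeping are imported from the template):
* the output of a fan-in-two circuit for `g ≠ 0` hits all `|ι|` rows (all row margins are
  positive) and `3 |ι| > 2 |ι|`, so the descent finds a gate value with row support `k`,
  `|ι| < 3k ≤ 2 |ι|` (`exists_balanced_gate`);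
* zero that gate `v`: `P.eval = (P.zeroAt v).eval + p_v · q` (`exists_eval_eq_zeroAt_add`); if
  `q ≠ 0` then `supp p_v + supp q ⊆ supp g` types `p_v` and `{ρ ≠ 0}` is the row support of
  `p_v`; the new gate values lie coefficientwise below the old ones and vanish at `v`, so at most
  `size P = L(g)` rounds occur (`exists_typed_list`).
[cite: JerrumSnir1982, §3.1 Lemma 3.1 and §3.3]
-/

open MvPolynomial
open Literature.Computability.AlgebraicComplexity
open Literature.Computability.AlgebraicComplexity.ArithCircuit
open scoped NNReal BigOperators
set_option linter.dupNamespace false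
noncomputable section

namespace Summit.ValiantsHypothesis.ValiantsHypothesis.Theorems.DivisionGapZeroOneTransfer

namespace DimerTypedDecomposition

open Literature.Barriers.ValiantsHypothesis
open Summit.ValiantsHypothesis.ValiantsHypothesis.Theorems.DivisionGap.PerMultiplesHard.TypedDecomposition
  (exists_window_operand card_image_fst_vars_add_le card_image_fst_vars_mul_le
    card_image_fst_vars_smul_le card_image_fst_vars_X card_image_fst_vars_C
    getD_gateValues_set_zeroGate eq_zero_of_zero_eq_add)

variable {ι κ : Type*} [Fintype ι] [Fintype κ] [DecidableEq ι] [DecidableEq κ]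

omit [DecidableEq κ] in
/-- If every monomial of `g ≠ 0` has the row margins `R`, all positive, then every row is hit:
the row support of `g` is everything. [folklore] -/
theorem image_fst_vars_eq_univ {g : MvPolynomial (ι × κ) ℝ≥0} {R : ι → ℕ}
    (hg : ∀ m ∈ g.support, ∀ i, ∑ j, m (i, j) = R i) (hR : ∀ i, R i ≠ 0) (h0 : g ≠ 0) :
    g.vars.image Prod.fst = Finset.univ := by
  obtain ⟨m, hm⟩ := support_nonempty.mpr h0
  refine Finset.eq_univ_of_forall fun i => ?_
  have hi : ∑ j, m (i, j) ≠ 0 := by rw [hg m hm i]; exact hR i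
  obtain ⟨j, -, hj⟩ := Finset.exists_ne_zero_of_sum_ne_zero hi
  exact Finset.mem_image.mpr
    ⟨(i, j), (mem_vars_iff_mem_support _).mpr ⟨m, hm, Finsupp.mem_support_iff.mpr hj⟩, rfl⟩

omit [DecidableEq κ] in
/-- For a typed `p ≠ 0` (all monomials have the row margins `ρ`) the rows with nonzero margin
are exactly the row support of `p`. [folklore] -/
theorem filter_ne_zero_eq_image_fst_vars {p : MvPolynomial (ι × κ) ℝ≥0} {ρ : ι → ℕ}
    (hp : ∀ m ∈ p.support, ∀ i, ∑ j, m (i, j) = ρ i) (h0 : p ≠ 0) :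
    (Finset.univ.filter fun i => ρ i ≠ 0) = p.vars.image Prod.fst := by
  obtain ⟨m₀, hm₀⟩ := support_nonempty.mpr h0
  ext i
  simp only [Finset.mem_filter, Finset.mem_univ, true_and, Finset.mem_image,
    mem_vars_iff_mem_support, Prod.exists]
  constructor
  · intro hi
    rw [← hp m₀ hm₀ i] at hi
    obtain ⟨j, -, hj⟩ := Finset.exists_ne_zero_of_sum_ne_zero hi
    exact ⟨i, j, ⟨m₀, hm₀, Finsupp.mem_support_iff.mpr hj⟩, rfl⟩
  · rintro ⟨i', j, ⟨m, hm, he⟩, hii'⟩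
    subst hii'
    rw [← hp m hm i']
    intro hsum
    exact (Finsupp.mem_support_iff.mp he) (Finset.sum_eq_zero_iff.mp hsum j (Finset.mem_univ _))

/-- Gate typing: if `supp (p * q) ⊆ supp g` with `q ≠ 0` and every monomial of `g` has margins
`(R, C)`, then every monomial of `p` has the margins of `g` minus those of one fixed monomial of `q`
(no cancellation over `ℝ≥0`: `supp (p * q) = supp p + supp q`).
[cite: JerrumSnir1982, §3.1 (Lemma 3.1(iii))] -/
theorem exists_margins_of_support_mul_subset {g p q : MvPolynomial (ι × κ) ℝ≥0}
    {R : ι → ℕ} {C' : κ → ℕ}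
    (hg : ∀ m ∈ g.support, (∀ i, ∑ j, m (i, j) = R i) ∧ (∀ j, ∑ i, m (i, j) = C' j))
    (hpq : (p * q).support ⊆ g.support) (hq : q ≠ 0) :
    ∃ (ρ : ι → ℕ) (γ : κ → ℕ),
      ∀ m ∈ p.support, (∀ i, ∑ j, m (i, j) = ρ i) ∧ (∀ j, ∑ i, m (i, j) = γ j) := by
  obtain ⟨b, hb⟩ := support_nonempty.mpr hq
  refine ⟨fun i => R i - ∑ j, b (i, j), fun j => C' j - ∑ i, b (i, j), fun m hm => ?_⟩
  have hmb : m + b ∈ g.support :=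
    hpq (by rw [JerrumSnir.support_mul_eq]; exact Finset.add_mem_add hm hb)
  obtain ⟨hr, hc⟩ := hg _ hmb
  refine ⟨fun i => ?_, fun j => ?_⟩
  · have h := hr i
    simp only [Finsupp.coe_add, Pi.add_apply, Finset.sum_add_distrib] at h
    show ∑ j, m (i, j) = R i - ∑ j, b (i, j)
    omega
  · have h := hc j
    simp only [Finsupp.coe_add, Pi.add_apply, Finset.sum_add_distrib] at h
    show ∑ i, m (i, j) = C' j - ∑ i, b (i, j)
    omega

/-- **A balanced gate.** If a fan-in-two circuit over `ℝ≥0` computes a nonzero polynomial in the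
`ι × κ` variables (`|ι| = N ≥ 3`) all of whose monomials have the positive row margins `R`, then
some gate value `p` has row support `rows p` of size `k` with `N < 3k ≤ 2N`: the output hits all
`N` rows (`3N > 2N`) and the descent applies to the row-support count.
[cite: JerrumSnir1982, §3.3 (proof of Thm. 3.4)] -/
theorem exists_balanced_gate (N : ℕ) (hN : Fintype.card ι = N) (h3 : 3 ≤ N)
    (R : ι → ℕ) (hR : ∀ i, R i ≠ 0) (P : ArithCircuit ℝ≥0 (ι × κ)) (h2 : P.IsFanInTwo)
    (hg : ∀ m ∈ P.eval.support, ∀ i, ∑ j, m (i, j) = R i) (h0 : P.eval ≠ 0) :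
    ∃ v : ℕ, N < 3 * (((gateValues P.gates).getD v 0).vars.image Prod.fst).card ∧
      3 * (((gateValues P.gates).getD v 0).vars.image Prod.fst).card ≤ 2 * N := by
  have huniv := image_fst_vars_eq_univ hg hR h0
  have hout : 2 * N < 3 * (P.eval.vars.image Prod.fst).card := by
    rw [huniv, Finset.card_univ, hN]; omega
  exact exists_window_operand P.gates h2
    (fun p : MvPolynomial (ι × κ) ℝ≥0 => (p.vars.image Prod.fst).card) N
    card_image_fst_vars_add_le card_image_fst_vars_mul_le card_image_fst_vars_smul_le
    (fun e => by rw [card_image_fst_vars_X]; omega) card_image_fst_vars_C P.output hout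

/-- **The peeling induction.** A fan-in-two circuit over `ℝ≥0` whose gate values vanish outside a
set `Z` of at most `M` indices and whose output is typed with margins `(R, C)`, all `R i > 0`,
writes its output as a sum of at most `M` products `a · b`, every `a` typed with balanced row
support: zero a balanced gate `v` (`exists_eval_eq_zeroAt_add`), type `p_v` through
`supp (p_v · q) ⊆ supp P.eval` when `q ≠ 0`, and recurse on `P.zeroAt v` (values coefficientwise
below those of `P`, zero at `v`). [cite: JerrumSnir1982, §3 (Lemma 3.1(iii), Thm. 3.2)] -/
theorem exists_typed_list (N : ℕ) (hN : Fintype.card ι = N) (h3 : 3 ≤ N) (R : ι → ℕ)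
    (C : κ → ℕ) (hR : ∀ i, R i ≠ 0) :
    ∀ (M : ℕ) (P : ArithCircuit ℝ≥0 (ι × κ)), P.IsFanInTwo →
      (∃ Z : Finset ℕ, Z.card ≤ M ∧ ∀ j ∉ Z, (gateValues P.gates).getD j 0 = 0) →
      (∀ m ∈ P.eval.support, (∀ i, ∑ j, m (i, j) = R i) ∧ (∀ j, ∑ i, m (i, j) = C j)) →
      ∃ L : List (MvPolynomial (ι × κ) ℝ≥0 × MvPolynomial (ι × κ) ℝ≥0),
        L.length ≤ M ∧ P.eval = (L.map fun ab => ab.1 * ab.2).sum ∧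
        ∀ ab ∈ L, ∃ (ρ : ι → ℕ) (γ : κ → ℕ),
          (∀ m ∈ ab.1.support, (∀ i, ∑ j, m (i, j) = ρ i) ∧ (∀ j, ∑ i, m (i, j) = γ j)) ∧
          N < 3 * (Finset.univ.filter fun i => ρ i ≠ 0).card ∧
          3 * (Finset.univ.filter fun i => ρ i ≠ 0).card ≤ 2 * N := by
  intro M
  induction M with
  | zero =>
    rintro P h2 ⟨Z, hZc, hZ0⟩ hg
    by_cases h0 : P.eval = 0
    · exact ⟨[], le_rfl, by simp [h0], by simp⟩
    · exfalso
      obtain ⟨v, hlo, -⟩ := exists_balanced_gate N hN h3 R hR P h2 (fun m hm => (hg m hm).1) h0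
      have hv : (gateValues P.gates).getD v 0 = 0 :=
        hZ0 v (by simp [Finset.card_eq_zero.mp (Nat.le_zero.mp hZc)])
      rw [hv, vars_0, Finset.image_empty, Finset.card_empty] at hlo
      omega
  | succ M ih =>
    rintro P h2 ⟨Z, hZc, hZ0⟩ hg
    by_cases h0 : P.eval = 0
    · exact ⟨[], by simp, by simp [h0], by simp⟩
    obtain ⟨v, hlo, hhi⟩ := exists_balanced_gate N hN h3 R hR P h2 (fun m hm => (hg m hm).1) h0
    obtain ⟨q, hq⟩ := exists_eval_eq_zeroAt_add P v
    have hlink := linked_gateValues_set P.gates v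
    set p := (gateValues P.gates).getD v 0
    have hp0 : p ≠ 0 := by
      intro h
      rw [h, vars_0, Finset.image_empty, Finset.card_empty] at hlo
      omega
    have hvZ : v ∈ Z := by_contra fun h => hp0 (hZ0 v h)
    -- the zeroed circuit: values vanish outside `Z.erase v`, output still typed
    have hZ' : ∃ Z' : Finset ℕ, Z'.card ≤ M ∧
        ∀ j ∉ Z', (gateValues (P.zeroAt v).gates).getD j 0 = 0 := by
      refine ⟨Z.erase v, ?_, fun j hj => ?_⟩
      · rw [Finset.card_erase_of_mem hvZ]; omega
      · by_cases hjv : j = v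
        · subst hjv; exact getD_gateValues_set_zeroGate P.gates j
        · have hjZ : j ∉ Z := fun h => hj (Finset.mem_erase.mpr ⟨hjv, h⟩)
          obtain ⟨h, hh⟩ := hlink.2 j
          rw [hZ0 j hjZ] at hh
          exact eq_zero_of_zero_eq_add hh
    have hg' : ∀ m ∈ (P.zeroAt v).eval.support,
        (∀ i, ∑ j, m (i, j) = R i) ∧ (∀ j, ∑ i, m (i, j) = C j) :=
      fun m hm => hg m (support_subset_of_eq_add hq hm)
    obtain ⟨L, hLlen, hLsum, hLtyp⟩ := ih (P.zeroAt v) (h2.zeroAt v) hZ' hg'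
    by_cases hq0 : q = 0
    · refine ⟨L, by omega, ?_, hLtyp⟩
      rw [hq, hq0, mul_zero, add_zero, hLsum]
    · have hsub : (p * q).support ⊆ P.eval.support :=
        support_subset_of_eq_add (hq.trans (add_comm _ _))
      obtain ⟨ρ, γ, hty⟩ := exists_margins_of_support_mul_subset hg hsub hq0
      refine ⟨(p, q) :: L, by simpa using hLlen, ?_, ?_⟩
      · simp only [List.map_cons, List.sum_cons]
        rw [hq, hLsum, add_comm]
      · intro ab hab
        rcases List.mem_cons.mp hab with rfl | hab
        · refine ⟨ρ, γ, hty, ?_⟩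
          rw [filter_ne_zero_eq_image_fst_vars (fun m hm => (hty m hm).1) hp0]
          exact ⟨hlo, hhi⟩
        · exact hLtyp ab hab

/-- **The typed, row-support-balanced decomposition, arbitrary finite row/column types.** For a
row type `ι` with `|ι| = N ≥ 3`, a torus-homogeneous `g` over `ℝ≥0` in the `ι × κ` variables (all
monomials have margins `(R, C)`) with all `R i ≠ 0` writes as `g = Σ_{t < s} a_t · b_t` with
`s ≤ L(g)` and every `a_t` torus-homogeneous with margins `(ρ, γ)`, `N < 3 · #{i | ρ i ≠ 0} ≤ 2N`:
peel (`exists_typed_list`) a minimal fan-in-two circuit for `g` (`exists_computes_size_eq_complexity`)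
at most `size = L(g)` times. [cite: JerrumSnir1982, §3 (Lemma 3.1(iii), Thm. 3.2, proof of Thm. 3.4)] -/
theorem typedDecomposition_general (N : ℕ) (hN : Fintype.card ι = N) (h3 : 3 ≤ N)
    (g : MvPolynomial (ι × κ) ℝ≥0) (R : ι → ℕ) (C : κ → ℕ)
    (hg : ∀ m ∈ g.support, (∀ i, ∑ j, m (i, j) = R i) ∧ (∀ j, ∑ i, m (i, j) = C j))
    (hR : ∀ i, R i ≠ 0) :
    ∃ s : ℕ, s ≤ complexity g ∧
      ∃ a b : Fin s → MvPolynomial (ι × κ) ℝ≥0,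
        g = ∑ t, a t * b t ∧
        ∀ t, ∃ (ρ : ι → ℕ) (γ : κ → ℕ),
          (∀ m ∈ (a t).support, (∀ i, ∑ j, m (i, j) = ρ i) ∧ (∀ j, ∑ i, m (i, j) = γ j)) ∧
          N < 3 * (Finset.univ.filter fun i => ρ i ≠ 0).card ∧
          3 * (Finset.univ.filter fun i => ρ i ≠ 0).card ≤ 2 * N := by
  obtain ⟨P, h2, hPg, hsize⟩ := exists_computes_size_eq_complexity g
  have heval : P.eval = g := hPg
  subst heval
  have hZ : ∃ Z : Finset ℕ, Z.card ≤ P.size ∧ ∀ j ∉ Z, (gateValues P.gates).getD j 0 = 0 := by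
    refine ⟨Finset.range P.size, by simp, fun j hj => getD_gateValues_eq_zero ?_⟩
    exact List.getElem?_eq_none_iff.mpr (by simpa [ArithCircuit.size] using hj)
  obtain ⟨L, hLlen, hLsum, hLtyp⟩ := exists_typed_list N hN h3 R C hR P.size P h2 hZ hg
  refine ⟨L.length, hsize ▸ hLlen, fun t => (L[t.1]).1, fun t => (L[t.1]).2, ?_,
    fun t => hLtyp _ (List.getElem_mem _)⟩
  rw [Fin.sum_univ_fun_getElem L (fun ab => ab.1 * ab.2)]
  exact hLsum

end DimerTypedDecomposition

open DimerTypedDecomposition in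
/-- **Stub D7 — TYPED ROW-SUPPORT-BALANCED DECOMPOSITION, vertex-indexed variables** (port of the
landed `PerMultiplesHard.TypedDecomposition.stub_typedDecomposition` from `Fin n × Fin n` to
`(Fin n × Fin n) × (Fin n × Fin n)`): a polynomial over `ℝ≥0` all of whose monomials have first-vertex
sums `R` (all nonzero) and second-vertex sums `C` is a sum of `s ≤ L₊(g)` products `a_t · b_t` with
every `a_t` typed `(ρ, γ)` and `n² < 3 #{ρ ≠ 0} ≤ 2 n²` (`typedDecomposition_general` with row type
`Fin n × Fin n`, `|Fin n × Fin n| = n * n ≥ 4`). [cite: JerrumSnir1982, §3.1 Lemma 3.1 and §3.3] -/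
theorem stub_dimerTypedDecomposition :
    ∀ (n : ℕ), 2 ≤ n → ∀ (g : MvPolynomial ((Fin n × Fin n) × (Fin n × Fin n)) ℝ≥0)
      (R C : Fin n × Fin n → ℕ),
      (∀ m ∈ g.support, (∀ i, ∑ j, m (i, j) = R i) ∧ (∀ j, ∑ i, m (i, j) = C j)) → (∀ i, R i ≠ 0) →
      ∃ s : ℕ, s ≤ complexity g ∧
        ∃ a b : Fin s → MvPolynomial ((Fin n × Fin n) × (Fin n × Fin n)) ℝ≥0,
          g = ∑ t, a t * b t ∧
          ∀ t, ∃ ρ γ : Fin n × Fin n → ℕ,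
            (∀ m ∈ (a t).support, (∀ i, ∑ j, m (i, j) = ρ i) ∧ (∀ j, ∑ i, m (i, j) = γ j)) ∧
            n * n < 3 * (Finset.univ.filter fun i => ρ i ≠ 0).card ∧
            3 * (Finset.univ.filter fun i => ρ i ≠ 0).card ≤ 2 * (n * n) := by
  intro n hn g R C hg hR
  have hN : Fintype.card (Fin n × Fin n) = n * n := by
    rw [Fintype.card_prod, Fintype.card_fin]
  have h3 : 3 ≤ n * n := le_trans (by norm_num) (Nat.mul_le_mul hn hn)
  exact typedDecomposition_general (n * n) hN h3 g R C hg hR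

end Summit.ValiantsHypothesis.ValiantsHypothesis.Theorems.DivisionGapZeroOneTransfer
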